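import Literature.NumberTheory.Automorphic.Liu2021.LemD1Item1AtV2AnisotropicDichotomy
import Literature.NumberTheory.Automorphic.Liu2021.LemD1Item1AtV2OfAnisotropicPin
import HarnessLib

/-!
# [Liu2021, Lem. D.1, first sentence + (1)] — the booked letters ★ `LemD1_1AsPrintedNonsplitCM₂` ∕ ★ `LemD1_1AsPrintedCM₂` FROM THE PIN ALONE:
# «at every anisotropic non-split place the `μ_v|_{E¹}`-coinvariants of the θ-package's local Weil factor vanish» — PROVED composition (theorems only)

Topic `NumberTheory/Automorphic/Liu2021`; namespaces `Literature.NumberTheory.Automorphic.Liu2021.Def411WeilCarriers` (§1–§2),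
`Literature.NumberTheory.Automorphic.Liu2021.LemD1RankTwoCMLetters` (§3).  KERNEL: theorems only (no definition, no named fact, no `sorry`, no instance,
no notation).  Cell hodgecm-mathlib, floor 0, half-A line LD1 (seat LD1-p02 (g3)); `--supports stmt-HodgeConjecture-24832`.  COMPOSITION of
★ p850021∕p850092 `LemD1Item1AtV2AnisotropicDichotomy` (B-p04 (g43): road (R) — at an anisotropic non-split place EXACTLY ONE central character kills the
local Weil factor, ★ `rankOne_theta_anisotropicPlane_dichotomy_centre` read on the rank-2 datum over a diagonal frame, ED. 2 exporting it in the local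
coinvariant currency) with ★ p850017 `LemD1Item1AtV2OfAnisotropicPin` (LD1-p02 (g3): the letters from (hR) «exactly one vanishing character» ∧ (hP) «a pinned
character vanishes»).  Net statement: THE LETTERS FROM (hP) ALONE.

* §1 `lemD1_1AsPrinted_localLemD1DataAtV₂_of_isField_of_isAnisotropic_of_localVanishing` — GENERIC `N = 2`, diagonal frame: `E_v` a field, the datum anisotropic, and
  (hP) «∃ χ′ : U(⟨a⟩)(F_v) →* ℂˣ, (∀ x, χ′(θ(x/x̄)) = μ_v(x)²) ∧ Coinv_{χ′}(ω_v ∘ (z ↦ z·1)) = 0» ⇒ `LemD1_1AsPrinted (localLemD1DataAtV₂ … v)`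
  (★ p850017 §1 with (hR) := ★ p850092 `exists_vanishing_coinv_localCenter_of_isField_of_hilbertSymbol` (B-p04 (g43): (R) = ★
  `rankOne_theta_anisotropicPlane_dichotomy_centre` read on the datum, EXPORTED in the local coinvariant currency), the Hilbert symbol from anisotropy by
  ★ `hilbertSymbol_eq_neg_one_of_isAnisotropic_localLemD1DataAtV₂`).
* §2 `…_cm_of_forall_smul_eq_of_isAnisotropic_of_localVanishing` — the reading on the rank-2 CM θ-package `(λ′, a′, χ)` at ONE anisotropic non-split place
  (`L_v` a field by ★ `isField_localRing_cm_of_forall_smul_eq`).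
* §3 `LemD1RankTwoCMLetters.lemD1_1AsPrintedNonsplitCM₂_of_forall_localVanishing` ∕ `lemD1_1AsPrintedCM₂_of_forall_localVanishing` — THE BOOKED LETTERS L1ns ∕ L1 from
  «∀ (L, dV, e₁, χ, a′, λ′) ∀ v non-split anisotropic, ∃ χ′ pinned at `μ_v²` with `Coinv_{χ′}(ω_{𝓢_{λ′,a′},v} ∘ (z ↦ z·1)) = 0`» ALONE (★ p850017 §3;
  (R) = ★ p850092 at every place).  The pinned character EXISTS and is `μ_v ∘ det` (★ `LemD1OfPlace.exists_centreChar_apply_theta_divConj_eq_mu_sq`), so the hypothesis is ONE vanishing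
  statement per place: the printed residue [HarrisKudlaSweet1996, Prop. 5.1 (iii)] of [Liu2021, Lem. D.1 (1)] (road (P) of the cell).

HONEST SCOPE: nothing of [Liu2021] is asserted; compositions of ★ theorems of the tree.  The vanishing hypothesis (P) is NOT proved here.  HC_CM is proved
only modulo the printed citations — the 2 remaining named inputs (hLiu418 = stmt-HodgeConjecture-24832, h413 = 24833) — until rung 0 closes; this file
touches no book.

## References
* [Liu2021] Y. Liu, *Fourier–Jacobi cycles and arithmetic relative trace formula*, Camb. J. Math. 9 (2021) = arXiv:2102.11518, App. D Lemma D.1, first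
  sentence + (1) (p. 125, l. 5226–5229); proof l. 5243–5245 (p. 126).
* [HarrisKudlaSweet1996] M. Harris, S. Kudla, W. J. Sweet, *Theta dichotomy for unitary groups*, J. AMS 9 (1996), Prop. 5.1 (iii), Thm. 6.1.
* [MoeglinVignerasWaldspurger1987] C. Mœglin, M.-F. Vignéras, J.-L. Waldspurger, LNM 1291 (1987), Chap. 3 §IV.2, §IV.4 Théorème principal.
-/

set_option autoImplicit false

noncomputable section

open scoped Matrix Kronecker TensorProduct Classical RestrictedProduct
open NumberField IsDedekindDomain Filter Set
open _root_.MeasureTheory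
open Literature.NumberTheory Literature.NumberTheory.Automorphic Literature.NumberTheory.Automorphic.UnitaryGroup
open Literature.NumberTheory.Weil1964 Literature.RepresentationTheory
open Literature.RepresentationTheory.HeisenbergGroup
open Literature.RepresentationTheory.Liu2021 (OscillatorStandingData)
open Literature.RepresentationTheory.CentralCharacterQuotient (augmentation)
open Literature.RepresentationTheory.MoeglinVignerasWaldspurger1987

/-! ## §1 (R) in the local coinvariant currency, and item (1) from the pin alone — GENERIC rank-2 datum over a diagonal frame -/

namespace Literature.NumberTheory.Automorphic.Liu2021.Def411WeilCarriers

open Literature.NumberTheory.GelbartRogawski1991 Literature.NumberTheory.GelbartRogawski1991.UnitaryDualPair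
open Literature.NumberTheory.GelbartRogawski1991.UnitaryDualPair.WeilCoinv
open Literature.NumberTheory.GelbartRogawski1991.UnitaryDualPair.LocalSplitting
open Literature.NumberTheory.GelbartRogawski1991.GRConstruction

section AtV

variable (F E : Type) [Field F] [NumberField F] [Field E] [NumberField E] [Algebra F E]
variable (c : E ≃ₐ[F] E) {n : ℕ} (e : Fin 2 × Fin 1 ≃ Fin n)
variable (JV : Matrix (Fin 2) (Fin 2) E) {TV : Matrix (Fin 2) (Fin 2) F}
variable [Algebra.IsQuadraticExtension F E] {δ : E} (hcδ : c δ = -δ) (hδ : δ ≠ 0) {d : F} (hd : δ * δ = algebraMap F E d)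

/-- **[Liu2021, Lem. D.1, first sentence + (1)] AS PRINTED at an ANISOTROPIC NON-SPLIT place FROM THE PIN ALONE — GENERIC rank-2 datum over a diagonal
frame.**  `E_v` a field, the datum `localLemD1DataAtV₂ F E c 2 e J_V … a 𝓢 … μ … χ v` anisotropic, and (hP) «∃ χ′ : U(⟨a⟩)(F_v) →* ℂˣ with
`χ′(θ(x/x̄)) = μ_v(x)²` for every unit `x` of `E_v` and `Coinv_{χ′}(ω_v ∘ (z ↦ z·1)) = 0`» ⇒ `LemD1_1AsPrinted (…)`: ★ p850017 §1 with its (hR) supplied by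
★ `exists_vanishing_coinv_localCenter_of_isField_of_hilbertSymbol` (p850092, B-p04 (g43): (R) in the local coinvariant currency; the Hilbert symbol from
anisotropy by ★ `hilbertSymbol_eq_neg_one_of_isAnisotropic_localLemD1DataAtV₂`).
(The pinned `χ′` exists — it is `μ_v ∘ det`, ★ `LemD1OfPlace.exists_centreChar_apply_theta_divConj_eq_mu_sq` — so (hP) is ONE vanishing statement.)
[cite: Liu2021, App. D Lemma D.1 (1) (p. 125, l. 5226–5229); proof l. 5243–5245 (p. 126)] [cite: HarrisKudlaSweet1996, Prop. 5.1 (iii)]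
[cite: MoeglinVignerasWaldspurger1987, Chap. 3 IV.4 Thm principal 1a), 2a)] -/
theorem lemD1_1AsPrinted_localLemD1DataAtV₂_of_isField_of_isAnisotropic_of_localVanishing (hV : TV.IsSymm) (hVd : IsUnit TV.det)
    (hJV : JV = TV.map (algebraMap F E)) (t : Fin 2 → Fˣ) (hTV : TV = Matrix.diagonal fun i => (t i : F)) (a : Fˣ)
    (𝓢 : LocalSplitting.FinLocalSplittings F E c n hcδ hδ hd (gram F e TV (TW F a)) (isSymm_gram F e hV (isSymm_TW F a))
      (reindex_kronecker_eq_gram_map F E e hJV (JW_eq F E a)))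
    (hn : 2 ≤ n) (μ : ∀ v : HeightOneSpectrum (𝓞 F), (LocalRing E v)ˣ →* ℂˣ) (hμn : ∀ v x, ‖((μ v x : ℂˣ) : ℂ)‖ = 1)
    (hμc : ∀ v, Continuous fun x => ((μ v x : ℂˣ) : ℂ))
    (hμF : ∀ (v : HeightOneSpectrum (𝓞 F)) (t : (v.adicCompletion F)ˣ),
      μ v (Units.map (algebraMap (v.adicCompletion F) (LocalRing E v)).toMonoidHom t) = 1 ↔
        ∃ x : (LocalRing E v)ˣ, (x : LocalRing E v) * conjLocal E c v x = algebraMap (v.adicCompletion F) (LocalRing E v) t)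
    (χ : Chi F E c) (v : HeightOneSpectrum (𝓞 F)) (hf : IsField (LocalRing E v))
    (han : (localLemD1DataAtV₂ F E c 2 e JV hcδ hδ hd hV hVd hJV a 𝓢 hn μ hμn hμc hμF χ v).IsAnisotropic)
    (hP : ∃ χ' : localPi E c 1 (JW F E a) v →* ℂˣ,
      (∀ x : (LocalRing E v)ˣ,
        χ' (LemD1OfPlace.theta E v c 2 JV hcδ hδ (le_refl 2) (transpose_map_conj_JV F E c 2 JV hV hJV)
            (det_JV_ne_zero F E 2 JV hVd hJV) (JW F E a)
          ((LemD1OfPlace.standingData E v c 2 JV hcδ hδ (le_refl 2) (transpose_map_conj_JV F E c 2 JV hV hJV)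
            (det_JV_ne_zero F E 2 JV hVd hJV)).divConj x)) = μ v x ^ 2) ∧
      Subsingleton (TwistedCoinv.Coinv
          (show Representation ℂ (localPi E c 1 (JW F E a) v) (SchwartzBruhat (Fin n → v.adicCompletion F)) from
            (𝓢.omegaLoc v).comp (localCenter E c n (Matrix.reindex e e (JV ⊗ₖ JW F E a)) (JW F E a) (JW_apply_ne_zero F E a) v)) χ')) :
    LemD1_1AsPrinted (localLemD1DataAtV₂ F E c 2 e JV hcδ hδ hd hV hVd hJV a 𝓢 hn μ hμn hμc hμF χ v) :=
  lemD1_1AsPrinted_localLemD1DataAtV₂_of_isField_of_isAnisotropic_of_pinnedDichotomy F E c 2 e JV hcδ hδ hd hV hVd hJV a 𝓢 hn μ hμn hμc hμF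
    χ v hf rfl han
    (exists_vanishing_coinv_localCenter_of_isField_of_hilbertSymbol F E c e JV hcδ hδ hd hV hVd hJV t hTV a 𝓢 v hf
      (hilbertSymbol_eq_neg_one_of_isAnisotropic_localLemD1DataAtV₂ F E c e JV hcδ hδ hd hV hVd hJV t hTV a 𝓢 hn μ hμn hμc hμF χ v han))
    hP

end AtV

/-! ## §2 The reading on the rank-2 CM θ-package at ONE anisotropic non-split place -/

section CM

open NumberField.mixedEmbedding NumberField.InfinitePlace
open Literature.NumberTheory.GaloisRepresentations Literature.RepresentationTheory.HarrisKudlaSweet1996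
open Literature.NumberTheory.Automorphic.IdeleClassGroup Literature.RepresentationTheory.Liu2021
open Literature.NumberTheory.Automorphic.Liu2021.Def411WeilCarriersDoubling

-- the CM tokens are large: one unification of the package terms against §1 (junction budget, as in ★ p850021 §3)
set_option maxHeartbeats 400000 in
/-- **[Liu2021, Lem. D.1, first sentence + (1)] AS PRINTED on the rank-2 CM θ-package `(λ′, a′, χ)` at a NON-SPLIT finite place `v` of `L⁺` where the
plane `(L_v², diag dV)` is ANISOTROPIC, FROM THE PIN ALONE.**  Binders = those of the letter ★ `LemD1RankTwoCMLetters.LemD1_1AsPrintedNonsplitCM₂` at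
ONE place `v`, the non-split guard `hv`, the anisotropy hypothesis `han` on the letter's own datum term, and (hP) «some character `χ′` of `U(⟨a′⟩)(L⁺_v)` with
`χ′(θ(x/x̄)) = μ_v(x)²` (`μ_v = localMu L (toHeckeCharacter L λ′) v`) has zero coinvariants in `ω_{𝓢_{λ′,a′},v}` along the centre».  Conclusion LITERALLY the
letter's body at `v` (§1 on the letter's binders; `L_v` a field by ★ `isField_localRing_cm_of_forall_smul_eq`).
[cite: Liu2021, App. D Lemma D.1 (1) (p. 125, l. 5226–5229); proof l. 5243–5245 (p. 126)] [cite: HarrisKudlaSweet1996, Prop. 5.1 (iii)]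
[cite: MoeglinVignerasWaldspurger1987, Chap. 3 IV.4 Thm principal 1a), 2a)] -/
theorem lemD1_1AsPrinted_localLemD1DataAtV₂_cm_of_forall_smul_eq_of_isAnisotropic_of_localVanishing
    (L : Type) [Field L] [NumberField L] [IsCMField L]
      (dV : Fin 2 → L) (hdV : ∀ i, IsCMField.complexConj L (dV i) = dV i) (hdV0 : ∀ i, dV i ≠ 0)
      {n' : ℕ} (e₁ : Fin 2 × Fin 1 ≃ Fin n')
      (χ : Chi (↥(maximalRealSubfield L)) L (IsCMField.complexConj L)) (a' : (↥(maximalRealSubfield L))ˣ)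
      (lam' : Literature.NumberTheory.Automorphic.IdeleClassGroup L →ₜ* Circle) (hlam' : IsConjugateSymplectic L lam')
      (v : HeightOneSpectrum (𝓞 ↥(maximalRealSubfield L)))
    (hv : ∀ w : UnitaryGroup.PlacesOver L v, IsCMField.complexConj L • (w : HeightOneSpectrum (𝓞 L)) = w)
    (han : (localLemD1DataAtV₂ (Fp L) L (IsCMField.complexConj L) 2 e₁ (Matrix.diagonal dV) (complexConj_imagUnit L)
        (imagUnit_ne_zero L) (imagUnit_mul_self L) (realDiagonal_isSymm L dV hdV) (isUnit_det_realDiagonal L dV hdV hdV0)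
        (realDiagonal_map L dV hdV).symm a' (congrW L e₁ dV hdV (lineW L (TW (Fp L) a')) (complexConj_lineW L (TW (Fp L) a')) (realDiagonal_lineW L (TW (Fp L) a')) (diagonal_lineW L (TW (Fp L) a') (JW_eq (Fp L) L a')) (undoubledSplittings L e₁ dV hdV hdV0 (lineW L (TW (Fp L) a')) (complexConj_lineW L (TW (Fp L) a')) (lineW_ne_zero L (TW (Fp L) a') (isUnit_det_TW (Fp L) a')) (toHeckeCharacter L lam') (borelPlaceMeasure L) (cmFinLocalFamily L e₁ dV hdV hdV0 (lineW L (TW (Fp L) a')) (complexConj_lineW L (TW (Fp L) a')) (lineW_ne_zero L (TW (Fp L) a') (isUnit_det_TW (Fp L) a')) (toHeckeCharacter L lam') ((isOscillatorChar_toHeckeCharacter_iff lam').mpr hlam') (borelPlaceMeasure L))) (isSymm_TW (Fp L) a') (JW_eq (Fp L) L a')) (by -- `2 ≤ n'` (§D.1 «rank n ≥ 2»); the assembler's proof argument here is `two_le_of_finTwo_equiv e₁`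
          have h := Fintype.card_congr e₁
          simp only [Fintype.card_prod, Fintype.card_fin, mul_one] at h
          omega)
        (localMu L (toHeckeCharacter L lam')) (fun v x => norm_localMu L (toHeckeCharacter L lam') v (isUnitary_toHeckeCharacter L lam') x)
        (continuous_localMu L (toHeckeCharacter L lam'))
        (fun v t => localMu_toLocalRing_eq_one_iff L (toHeckeCharacter L lam') v ((isOscillatorChar_toHeckeCharacter_iff lam').mpr hlam') t)
        χ v).IsAnisotropic)
    (hP : (∃ χ' : localPi L (IsCMField.complexConj L) 1 (JW (Fp L) L a') v →* ℂˣ, (∀ x : (LocalRing L v)ˣ, χ' ((LemD1OfPlace.theta L v (IsCMField.complexConj L) 2 (Matrix.diagonal dV) (complexConj_imagUnit L) (imagUnit_ne_zero L) (le_refl 2) (transpose_map_conj_JV (Fp L) L (IsCMField.complexConj L) 2 (Matrix.diagonal dV) (realDiagonal_isSymm L dV hdV) (realDiagonal_map L dV hdV).symm) (det_JV_ne_zero (Fp L) L 2 (Matrix.diagonal dV) (isUnit_det_realDiagonal L dV hdV hdV0) (realDiagonal_map L dV hdV).symm) (JW (Fp L) L a')) ((LemD1OfPlace.standingData L v (IsCMField.complexConj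 L) 2 (Matrix.diagonal dV) (complexConj_imagUnit L) (imagUnit_ne_zero L) (le_refl 2) (transpose_map_conj_JV (Fp L) L (IsCMField.complexConj L) 2 (Matrix.diagonal dV) (realDiagonal_isSymm L dV hdV) (realDiagonal_map L dV hdV).symm) (det_JV_ne_zero (Fp L) L 2 (Matrix.diagonal dV) (isUnit_det_realDiagonal L dV hdV hdV0) (realDiagonal_map L dV hdV).symm)).divConj x)) = localMu L (toHeckeCharacter L lam') v x ^ 2) ∧
        Subsingleton (TwistedCoinv.Coinv (show Representation ℂ (localPi L (IsCMField.complexConj L) 1 (JW (Fp L) L a') v) (SchwartzBruhat (Fin n' → v.adicCompletion (Fp L))) from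
            ((congrW L e₁ dV hdV (lineW L (TW (Fp L) a')) (complexConj_lineW L (TW (Fp L) a')) (realDiagonal_lineW L (TW (Fp L) a')) (diagonal_lineW L (TW (Fp L) a') (JW_eq (Fp L) L a')) (undoubledSplittings L e₁ dV hdV hdV0 (lineW L (TW (Fp L) a')) (complexConj_lineW L (TW (Fp L) a')) (lineW_ne_zero L (TW (Fp L) a') (isUnit_det_TW (Fp L) a')) (toHeckeCharacter L lam') (borelPlaceMeasure L) (cmFinLocalFamily L e₁ dV hdV hdV0 (lineW L (TW (Fp L) a')) (complexConj_lineW L (TW (Fp L) a')) (lineW_ne_zero L (TW (Fp L) a') (isUnit_det_TW (Fp L) a')) (toHeckeCharacter L lam') ((isOscillatorChar_toHeckeCharacter_iff lam').mpr hlam') (borelPlaceMeasure L))) (isSymm_TW (Fp L) a') (JW_eq (Fp L) L a')).omegaLoc v).comp (localCenter L (IsCMField.complexConj L) n' (Matrix.reindex e₁ e₁ (Matrix.diagonal dV ⊗ₖ JW (Fp L) L a')) (JW (Fp L) L a')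
              (JW_apply_ne_zero (Fp L) L a') v)) χ'))) :
    LemD1_1AsPrinted (localLemD1DataAtV₂ (Fp L) L (IsCMField.complexConj L) 2 e₁ (Matrix.diagonal dV) (complexConj_imagUnit L)
        (imagUnit_ne_zero L) (imagUnit_mul_self L) (realDiagonal_isSymm L dV hdV) (isUnit_det_realDiagonal L dV hdV hdV0)
        (realDiagonal_map L dV hdV).symm a' (congrW L e₁ dV hdV (lineW L (TW (Fp L) a')) (complexConj_lineW L (TW (Fp L) a')) (realDiagonal_lineW L (TW (Fp L) a')) (diagonal_lineW L (TW (Fp L) a') (JW_eq (Fp L) L a')) (undoubledSplittings L e₁ dV hdV hdV0 (lineW L (TW (Fp L) a')) (complexConj_lineW L (TW (Fp L) a')) (lineW_ne_zero L (TW (Fp L) a') (isUnit_det_TW (Fp L) a')) (toHeckeCharacter L lam') (borelPlaceMeasure L) (cmFinLocalFamily L e₁ dV hdV hdV0 (lineW L (TW (Fp L) a')) (complexConj_lineW L (TW (Fp L) a')) (lineW_ne_zero L (TW (Fp L) a') (isUnit_det_TW (Fp L) a')) (toHeckeCharacter L lam') ((isOscillatorChar_toHeckeCharacter_iff lam').mpr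 hlam') (borelPlaceMeasure L))) (isSymm_TW (Fp L) a') (JW_eq (Fp L) L a')) (by -- `2 ≤ n'` (§D.1 «rank n ≥ 2»); the assembler's proof argument here is `two_le_of_finTwo_equiv e₁`
          have h := Fintype.card_congr e₁
          simp only [Fintype.card_prod, Fintype.card_fin, mul_one] at h
          omega)
        (localMu L (toHeckeCharacter L lam')) (fun v x => norm_localMu L (toHeckeCharacter L lam') v (isUnitary_toHeckeCharacter L lam') x)
        (continuous_localMu L (toHeckeCharacter L lam'))
        (fun v t => localMu_toLocalRing_eq_one_iff L (toHeckeCharacter L lam') v ((isOscillatorChar_toHeckeCharacter_iff lam').mpr hlam') t)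
        χ v) :=
  lemD1_1AsPrinted_localLemD1DataAtV₂_of_isField_of_isAnisotropic_of_localVanishing (Fp L) L (IsCMField.complexConj L) e₁ (Matrix.diagonal dV)
    (complexConj_imagUnit L) (imagUnit_ne_zero L) (imagUnit_mul_self L) (realDiagonal_isSymm L dV hdV) (isUnit_det_realDiagonal L dV hdV hdV0)
    (realDiagonal_map L dV hdV).symm
    (fun i => Units.mk0 (⟨dV i, (IsCMField.complexConj_eq_self_iff (K := L) (dV i)).1 (hdV i)⟩ : Fp L) (fun h => hdV0 i (congrArg Subtype.val h)))
    rfl a' _ _ _ _ _ _ χ v (isField_localRing_cm_of_forall_smul_eq L v hv) han hP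

end CM

end Literature.NumberTheory.Automorphic.Liu2021.Def411WeilCarriers

/-! ## §3 The letters ★ `LemD1_1AsPrintedNonsplitCM₂` ∕ ★ `LemD1_1AsPrintedCM₂` from the pin alone -/

namespace Literature.NumberTheory.Automorphic.Liu2021.LemD1RankTwoCMLetters

open NumberField.mixedEmbedding NumberField.InfinitePlace
open Literature.NumberTheory.GelbartRogawski1991 Literature.NumberTheory.GelbartRogawski1991.UnitaryDualPair
open Literature.NumberTheory.GelbartRogawski1991.UnitaryDualPair.WeilCoinv
open Literature.NumberTheory.GelbartRogawski1991.UnitaryDualPair.LocalSplitting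
open Literature.NumberTheory.GelbartRogawski1991.GRConstruction
open Literature.NumberTheory.GaloisRepresentations Literature.RepresentationTheory.HarrisKudlaSweet1996
open Literature.NumberTheory.Automorphic.IdeleClassGroup Literature.RepresentationTheory.Liu2021
open Literature.NumberTheory.Automorphic.Liu2021.Def411WeilCarriers
open Literature.NumberTheory.Automorphic.Liu2021.Def411WeilCarriersDoubling

set_option maxHeartbeats 400000 in
/-- **THE NON-SPLIT LETTER ★ `LemD1_1AsPrintedNonsplitCM₂` ([Liu2021, Lem. D.1, first sentence + (1)] on the rank-2 CM θ-packages at the non-split places)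
FROM THE PIN ALONE**: if for every CM field `L`, frame `dV`, `e₁`, `χ`, line `a′`, conjugate-symplectic `λ′` and every non-split finite place `v` of `L⁺` at
which the letter's datum is anisotropic, SOME character `χ′` of `U(⟨a′⟩)(L⁺_v)` pinned at `μ_v²` (`χ′(θ(x/x̄)) = μ_v(x)²`; e.g. `χ′ = μ_v ∘ det`, ★
`exists_centreChar_apply_theta_divConj_eq_mu_sq`) has ZERO coinvariants in the local Weil factor `ω_{𝓢_{λ′,a′},v}` along the centre, then the letter holds
(§2 through ★ `lemD1_1AsPrintedNonsplitCM₂_of_forall_localVanishingnedDichotomy`; (R) = §1, isotropic places ★ p849478, reduction ★ p849507).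
[cite: Liu2021, App. D Lemma D.1 (1) (p. 125, l. 5226–5229); proof l. 5241–5245 (p. 126)] [cite: HarrisKudlaSweet1996, Prop. 5.1 (iii)]
[cite: MoeglinVignerasWaldspurger1987, Chap. 3 IV.2; IV.4] -/
theorem lemD1_1AsPrintedNonsplitCM₂_of_forall_localVanishing
    (h : ∀ (L : Type) [Field L] [NumberField L] [IsCMField L]
      (dV : Fin 2 → L) (hdV : ∀ i, IsCMField.complexConj L (dV i) = dV i) (hdV0 : ∀ i, dV i ≠ 0)
      {n' : ℕ} (e₁ : Fin 2 × Fin 1 ≃ Fin n')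
      (χ : Chi (↥(maximalRealSubfield L)) L (IsCMField.complexConj L)) (a' : (↥(maximalRealSubfield L))ˣ)
      (lam' : Literature.NumberTheory.Automorphic.IdeleClassGroup L →ₜ* Circle) (hlam' : IsConjugateSymplectic L lam')
      (v : HeightOneSpectrum (𝓞 ↥(maximalRealSubfield L))),
      (∀ w : UnitaryGroup.PlacesOver L v, IsCMField.complexConj L • (w : HeightOneSpectrum (𝓞 L)) = w) →
      (localLemD1DataAtV₂ (Fp L) L (IsCMField.complexConj L) 2 e₁ (Matrix.diagonal dV) (complexConj_imagUnit L)
        (imagUnit_ne_zero L) (imagUnit_mul_self L) (realDiagonal_isSymm L dV hdV) (isUnit_det_realDiagonal L dV hdV hdV0)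
        (realDiagonal_map L dV hdV).symm a' (congrW L e₁ dV hdV (lineW L (TW (Fp L) a')) (complexConj_lineW L (TW (Fp L) a')) (realDiagonal_lineW L (TW (Fp L) a')) (diagonal_lineW L (TW (Fp L) a') (JW_eq (Fp L) L a')) (undoubledSplittings L e₁ dV hdV hdV0 (lineW L (TW (Fp L) a')) (complexConj_lineW L (TW (Fp L) a')) (lineW_ne_zero L (TW (Fp L) a') (isUnit_det_TW (Fp L) a')) (toHeckeCharacter L lam') (borelPlaceMeasure L) (cmFinLocalFamily L e₁ dV hdV hdV0 (lineW L (TW (Fp L) a')) (complexConj_lineW L (TW (Fp L) a')) (lineW_ne_zero L (TW (Fp L) a') (isUnit_det_TW (Fp L) a')) (toHeckeCharacter L lam') ((isOscillatorChar_toHeckeCharacter_iff lam').mpr hlam') (borelPlaceMeasure L))) (isSymm_TW (Fp L) a') (JW_eq (Fp L) L a')) (by -- `2 ≤ n'` (§D.1 «rank n ≥ 2»); the assembler's proof argument here is `two_le_of_finTwo_equiv e₁`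
          have h := Fintype.card_congr e₁
          simp only [Fintype.card_prod, Fintype.card_fin, mul_one] at h
          omega)
        (localMu L (toHeckeCharacter L lam')) (fun v x => norm_localMu L (toHeckeCharacter L lam') v (isUnitary_toHeckeCharacter L lam') x)
        (continuous_localMu L (toHeckeCharacter L lam'))
        (fun v t => localMu_toLocalRing_eq_one_iff L (toHeckeCharacter L lam') v ((isOscillatorChar_toHeckeCharacter_iff lam').mpr hlam') t)
        χ v).IsAnisotropic →
      (∃ χ' : localPi L (IsCMField.complexConj L) 1 (JW (Fp L) L a') v →* ℂˣ, (∀ x : (LocalRing L v)ˣ, χ' ((LemD1OfPlace.theta L v (IsCMField.complexConj L) 2 (Matrix.diagonal dV) (complexConj_imagUnit L) (imagUnit_ne_zero L) (le_refl 2) (transpose_map_conj_JV (Fp L) L (IsCMField.complexConj L) 2 (Matrix.diagonal dV) (realDiagonal_isSymm L dV hdV) (realDiagonal_map L dV hdV).symm) (det_JV_ne_zero (Fp L) L 2 (Matrix.diagonal dV) (isUnit_det_realDiagonal L dV hdV hdV0) (realDiagonal_map L dV hdV).symm) (JW (Fp L) L a')) ((LemD1OfPlace.standingData L v (IsCMField.complexConj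 L) 2 (Matrix.diagonal dV) (complexConj_imagUnit L) (imagUnit_ne_zero L) (le_refl 2) (transpose_map_conj_JV (Fp L) L (IsCMField.complexConj L) 2 (Matrix.diagonal dV) (realDiagonal_isSymm L dV hdV) (realDiagonal_map L dV hdV).symm) (det_JV_ne_zero (Fp L) L 2 (Matrix.diagonal dV) (isUnit_det_realDiagonal L dV hdV hdV0) (realDiagonal_map L dV hdV).symm)).divConj x)) = localMu L (toHeckeCharacter L lam') v x ^ 2) ∧
        Subsingleton (TwistedCoinv.Coinv (show Representation ℂ (localPi L (IsCMField.complexConj L) 1 (JW (Fp L) L a') v) (SchwartzBruhat (Fin n' → v.adicCompletion (Fp L))) from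
            ((congrW L e₁ dV hdV (lineW L (TW (Fp L) a')) (complexConj_lineW L (TW (Fp L) a')) (realDiagonal_lineW L (TW (Fp L) a')) (diagonal_lineW L (TW (Fp L) a') (JW_eq (Fp L) L a')) (undoubledSplittings L e₁ dV hdV hdV0 (lineW L (TW (Fp L) a')) (complexConj_lineW L (TW (Fp L) a')) (lineW_ne_zero L (TW (Fp L) a') (isUnit_det_TW (Fp L) a')) (toHeckeCharacter L lam') (borelPlaceMeasure L) (cmFinLocalFamily L e₁ dV hdV hdV0 (lineW L (TW (Fp L) a')) (complexConj_lineW L (TW (Fp L) a')) (lineW_ne_zero L (TW (Fp L) a') (isUnit_det_TW (Fp L) a')) (toHeckeCharacter L lam') ((isOscillatorChar_toHeckeCharacter_iff lam').mpr hlam') (borelPlaceMeasure L))) (isSymm_TW (Fp L) a') (JW_eq (Fp L) L a')).omegaLoc v).comp (localCenter L (IsCMField.complexConj L) n' (Matrix.reindex e₁ e₁ (Matrix.diagonal dV ⊗ₖ JW (Fp L) L a')) (JW (Fp L) L a')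
              (JW_apply_ne_zero (Fp L) L a') v)) χ'))) :
    LemD1_1AsPrintedNonsplitCM₂ :=
  lemD1_1AsPrintedNonsplitCM₂_of_forall_isAnisotropic fun L _ _ _ dV hdV hdV0 _ e₁ χ a' lam' hlam' v hv han =>
    lemD1_1AsPrinted_localLemD1DataAtV₂_cm_of_forall_smul_eq_of_isAnisotropic_of_localVanishing L dV hdV hdV0 e₁ χ a' lam' hlam' v hv han
      (h L dV hdV hdV0 e₁ χ a' lam' hlam' v hv han)

set_option maxHeartbeats 400000 in
/-- **… hence the ALL-PLACES letter ★ `LemD1_1AsPrintedCM₂` from the pin alone** (the split places are ★ `LemD1_1AsPrintedNonsplitCM₂.toAllPlaces`).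
[cite: Liu2021, App. D Lemma D.1 (1) (p. 125, l. 5226–5229); proof l. 5241–5245 (p. 126)] [cite: HarrisKudlaSweet1996, Prop. 5.1 (iii)]
[cite: MoeglinVignerasWaldspurger1987, Chap. 3 IV.2; IV.4] -/
theorem lemD1_1AsPrintedCM₂_of_forall_localVanishing
    (h : ∀ (L : Type) [Field L] [NumberField L] [IsCMField L]
      (dV : Fin 2 → L) (hdV : ∀ i, IsCMField.complexConj L (dV i) = dV i) (hdV0 : ∀ i, dV i ≠ 0)
      {n' : ℕ} (e₁ : Fin 2 × Fin 1 ≃ Fin n')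
      (χ : Chi (↥(maximalRealSubfield L)) L (IsCMField.complexConj L)) (a' : (↥(maximalRealSubfield L))ˣ)
      (lam' : Literature.NumberTheory.Automorphic.IdeleClassGroup L →ₜ* Circle) (hlam' : IsConjugateSymplectic L lam')
      (v : HeightOneSpectrum (𝓞 ↥(maximalRealSubfield L))),
      (∀ w : UnitaryGroup.PlacesOver L v, IsCMField.complexConj L • (w : HeightOneSpectrum (𝓞 L)) = w) →
      (localLemD1DataAtV₂ (Fp L) L (IsCMField.complexConj L) 2 e₁ (Matrix.diagonal dV) (complexConj_imagUnit L)
        (imagUnit_ne_zero L) (imagUnit_mul_self L) (realDiagonal_isSymm L dV hdV) (isUnit_det_realDiagonal L dV hdV hdV0)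
        (realDiagonal_map L dV hdV).symm a' (congrW L e₁ dV hdV (lineW L (TW (Fp L) a')) (complexConj_lineW L (TW (Fp L) a')) (realDiagonal_lineW L (TW (Fp L) a')) (diagonal_lineW L (TW (Fp L) a') (JW_eq (Fp L) L a')) (undoubledSplittings L e₁ dV hdV hdV0 (lineW L (TW (Fp L) a')) (complexConj_lineW L (TW (Fp L) a')) (lineW_ne_zero L (TW (Fp L) a') (isUnit_det_TW (Fp L) a')) (toHeckeCharacter L lam') (borelPlaceMeasure L) (cmFinLocalFamily L e₁ dV hdV hdV0 (lineW L (TW (Fp L) a')) (complexConj_lineW L (TW (Fp L) a')) (lineW_ne_zero L (TW (Fp L) a') (isUnit_det_TW (Fp L) a')) (toHeckeCharacter L lam') ((isOscillatorChar_toHeckeCharacter_iff lam').mpr hlam') (borelPlaceMeasure L))) (isSymm_TW (Fp L) a') (JW_eq (Fp L) L a')) (by -- `2 ≤ n'` (§D.1 «rank n ≥ 2»); the assembler's proof argument here is `two_le_of_finTwo_equiv e₁`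
          have h := Fintype.card_congr e₁
          simp only [Fintype.card_prod, Fintype.card_fin, mul_one] at h
          omega)
        (localMu L (toHeckeCharacter L lam')) (fun v x => norm_localMu L (toHeckeCharacter L lam') v (isUnitary_toHeckeCharacter L lam') x)
        (continuous_localMu L (toHeckeCharacter L lam'))
        (fun v t => localMu_toLocalRing_eq_one_iff L (toHeckeCharacter L lam') v ((isOscillatorChar_toHeckeCharacter_iff lam').mpr hlam') t)
        χ v).IsAnisotropic →
      (∃ χ' : localPi L (IsCMField.complexConj L) 1 (JW (Fp L) L a') v →* ℂˣ, (∀ x : (LocalRing L v)ˣ, χ' ((LemD1OfPlace.theta L v (IsCMField.complexConj L) 2 (Matrix.diagonal dV) (complexConj_imagUnit L) (imagUnit_ne_zero L) (le_refl 2) (transpose_map_conj_JV (Fp L) L (IsCMField.complexConj L) 2 (Matrix.diagonal dV) (realDiagonal_isSymm L dV hdV) (realDiagonal_map L dV hdV).symm) (det_JV_ne_zero (Fp L) L 2 (Matrix.diagonal dV) (isUnit_det_realDiagonal L dV hdV hdV0) (realDiagonal_map L dV hdV).symm) (JW (Fp L) L a')) ((LemD1OfPlace.standingData L v (IsCMField.complexConj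 L) 2 (Matrix.diagonal dV) (complexConj_imagUnit L) (imagUnit_ne_zero L) (le_refl 2) (transpose_map_conj_JV (Fp L) L (IsCMField.complexConj L) 2 (Matrix.diagonal dV) (realDiagonal_isSymm L dV hdV) (realDiagonal_map L dV hdV).symm) (det_JV_ne_zero (Fp L) L 2 (Matrix.diagonal dV) (isUnit_det_realDiagonal L dV hdV hdV0) (realDiagonal_map L dV hdV).symm)).divConj x)) = localMu L (toHeckeCharacter L lam') v x ^ 2) ∧
        Subsingleton (TwistedCoinv.Coinv (show Representation ℂ (localPi L (IsCMField.complexConj L) 1 (JW (Fp L) L a') v) (SchwartzBruhat (Fin n' → v.adicCompletion (Fp L))) from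
            ((congrW L e₁ dV hdV (lineW L (TW (Fp L) a')) (complexConj_lineW L (TW (Fp L) a')) (realDiagonal_lineW L (TW (Fp L) a')) (diagonal_lineW L (TW (Fp L) a') (JW_eq (Fp L) L a')) (undoubledSplittings L e₁ dV hdV hdV0 (lineW L (TW (Fp L) a')) (complexConj_lineW L (TW (Fp L) a')) (lineW_ne_zero L (TW (Fp L) a') (isUnit_det_TW (Fp L) a')) (toHeckeCharacter L lam') (borelPlaceMeasure L) (cmFinLocalFamily L e₁ dV hdV hdV0 (lineW L (TW (Fp L) a')) (complexConj_lineW L (TW (Fp L) a')) (lineW_ne_zero L (TW (Fp L) a') (isUnit_det_TW (Fp L) a')) (toHeckeCharacter L lam') ((isOscillatorChar_toHeckeCharacter_iff lam').mpr hlam') (borelPlaceMeasure L))) (isSymm_TW (Fp L) a') (JW_eq (Fp L) L a')).omegaLoc v).comp (localCenter L (IsCMField.complexConj L) n' (Matrix.reindex e₁ e₁ (Matrix.diagonal dV ⊗ₖ JW (Fp L) L a')) (JW (Fp L) L a')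
              (JW_apply_ne_zero (Fp L) L a') v)) χ'))) :
    LemD1_1AsPrintedCM₂ :=
  (lemD1_1AsPrintedNonsplitCM₂_of_forall_localVanishing h).toAllPlaces

end Literature.NumberTheory.Automorphic.Liu2021.LemD1RankTwoCMLetters

end
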